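import Literature.Geometry.Symplectic.HopfOpenBook
import Literature.Topology.FourManifolds.AchiralLefschetzModel
import Literature.Topology.FourManifolds.PlanarPageSmooth
import Mathlib.Analysis.SpecialFunctions.Complex.LogDeriv
import Mathlib.Analysis.SpecialFunctions.Trigonometric.InverseDeriv
import HarnessLib

/-!
# A page system by the annulus for the Hopf open book of `S³`: `IsPageSystem` does not pin the
# monodromy rel boundary

Topic `Literature/Geometry/Symplectic`; continues `HopfOpenBook.lean` (namespace
`Literature.Geometry.Symplectic.HopfOpenBook`).  Everything here is proved; no named facts.

The tree's interface for "the open book `(P, id)` trivialised by `J : P × ℝ → M`" is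
`Literature.Topology.FourManifolds.IsPageSystem ob J` (`AchiralLefschetzModel.lean`): `J` is smooth
and `1`-periodic on `int P × ℝ`, maps `int P × {θ}` injectively and immersively into the page over
`e^{2πiθ}`, and reaches every point off the binding; the values of `J` on `∂P × ℝ` are explicitly
unconstrained, and no clause relates `J` to the meridional discs of the binding tubes.  Hence the
interface only sees the page bundle over the OPEN page, i.e. the monodromy in
`Mod(int P) = Mod(P, ∂P)/⟨boundary twists⟩`.  This file makes that concrete:

* `HopfOpenBook.hopfPages : SmoothPlanarPage 1 × ℝ → S³`,
  `J (q, θ) = (sin φ(‖q‖²) · q/‖q‖, cos φ(‖q‖²) · e^{2πiθ} q̄/‖q‖)` with the affine profile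
  `φ(t) = (π/2)(t - ρ²)/(1 - ρ²)` (`ρ = 1/8` the hole radius of the model annulus
  `P₁ = SmoothPlanarPage 1 = {ρ ≤ ‖q‖ ≤ 1}`), carries the open annulus `{ρ < ‖q‖ < 1}` page by page
  onto the pages `{z₁z₂ ∈ ℝ₊e^{2πiθ}}` of the POSITIVE HOPF OPEN BOOK (`HopfOpenBook.hopfOpenBook`;
  monodromy a right-handed Dehn twist about the core of the annulus, Etnyre 2006, §2);
* **`HopfOpenBook.isPageSystem_hopfPages : IsPageSystem hopfOpenBook hopfPages`** — all six clauses: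
  smoothness (globally on `P₁ × ℝ`: the formula is smooth for `q ≠ 0` and the inclusion of the
  regular sublevel set is smooth), periodicity, pages (`z₁z₂ (J (q, θ)) = sin φ cos φ · e^{2πiθ}`),
  injectivity (`z₁` determines `q`), immersivity (chain rule through the smooth local left inverse
  `(G₁, G₂) : S³ → ℝ² × ℝ`, `G₁(z) = (√t(arcsin ‖z₁‖)/‖z₁‖) z₁`, `G₂(z) = θ₀ + arg(e^{-2πiθ₀} z₁z₂)/2π`,
  and `RegularSublevel.det_mfderiv_incl_ne_zero`), surjectivity onto `S³ ∖ (Hopf link)` (explicit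
  preimage).

Geometrically: the Dehn twist is isotopic to the identity through diffeomorphisms of the OPEN
annulus (unscrew the ends), so the page bundle of `(P₁, δ)` over the open page is trivial; the
factor `e^{2πiθ} q̄` rotates the two ends of the annulus against each other once per turn.
Consequence (`Topology/FourManifolds/PlanarLefschetzBodyCounterexample.lean`): `𝔻⁴` is a "planar
Lefschetz body over `P₁` with no letters", refuting two named facts of `PlanarLefschetzBodyFacts.lean`.

## References

* J. B. Etnyre, *Lectures on open book decompositions and contact structures*, Clay Math. Proc. 5
  (2006), §2 (the positive Hopf band `H⁺`, Def. 2.1 and the discussion of abstract open books and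
  monodromy rel boundary) (arXiv:math/0409402). [Etnyre2006]
-/

noncomputable section

open scoped Manifold ContDiff Topology RealInnerProductSpace ComplexConjugate
open Set Function

namespace Literature.Geometry.Symplectic

namespace HopfOpenBook

open Literature.Topology.FourManifolds SphereOpenBook PlanarPage

/-- Local notation: `ℝ⁴ = ℂ²`. -/
local notation "E4" => EuclideanSpace ℝ (Fin 4)
/-- Local notation: `ℝ³` (the chart model of `S³`). -/
local notation "E3" => EuclideanSpace ℝ (Fin 3)
/-- Local notation: `ℝ² = ℂ`. -/
local notation "E2" => EuclideanSpace ℝ (Fin 2)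
/-- Local notation: the unit sphere `S³ ⊂ ℂ²`. -/
local notation "S3" => (Metric.sphere (0 : EuclideanSpace ℝ (Fin 4)) 1)
/-- Local notation: the unit circle `S¹ ⊂ ℂ`. -/
local notation "S1" => (Metric.sphere (0 : EuclideanSpace ℝ (Fin 2)) 1)
/-- Local notation: the smooth model annulus `P₁` (disc with one hole). -/
local notation "P1" => SmoothPlanarPage 1

attribute [local instance] Literature.Topology.FourManifolds.fact_finrank_euclideanSpace_succ

open Real in
/-- Local notation: `π`. -/
local notation "π" => Real.pi

/-! ### The model annulus `P₁ = {ρ ≤ ‖p‖ ≤ 1}`, `ρ = 1/8` -/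

/-- The hole radius for one hole is `ρ = 1/8`. [folklore] -/
theorem holeRadius_one : holeRadius 1 = 1 / 8 := by
  norm_num [holeRadius]

/-- `0 < ρ`. [folklore] -/
theorem rho_pos : 0 < holeRadius 1 :=
  holeRadius_pos 1

/-- `ρ < 1`. [folklore] -/
theorem rho_lt_one : holeRadius 1 < 1 := by
  rw [holeRadius_one]; norm_num

/-- `ρ² < 1`. [folklore] -/
theorem rho_sq_lt_one : holeRadius 1 ^ 2 < 1 := by
  rw [holeRadius_one]; norm_num

/-- `0 < 1 - ρ²`. [folklore] -/
theorem one_sub_rho_sq_pos : 0 < 1 - holeRadius 1 ^ 2 :=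
  sub_pos.2 rho_sq_lt_one

/-- The single hole is centred at the origin. [folklore] -/
theorem centreE_one (j : Fin 1) : centreE 1 j = 0 := by
  have h : holeCentre 1 j = 0 := by
    fin_cases j
    norm_num [holeCentre]
  rw [centreE, h, Complex.ofReal_zero, map_zero]

/-- A point of the smooth annulus read in `ℝ²` (the tree's `RegularSublevel.incl`). [folklore] -/
def ι (q : P1) : E2 :=
  RegularSublevel.incl _ q

/-- `ι` is the inclusion (definitional). [folklore] -/
theorem ι_eq_incl (q : P1) : ι q = RegularSublevel.incl _ q := rfl

/-- Points of `P₁` satisfy `ρ ≤ ‖q‖ ≤ 1`. [folklore] -/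
theorem rho_le_norm_and_norm_le_one (q : P1) : holeRadius 1 ≤ ‖ι q‖ ∧ ‖ι q‖ ≤ 1 := by
  have h : ι q ∈ pageSetE 1 := levelFun_le_zero_iff.1 (RegularSublevel.apply_incl_le _ q)
  refine ⟨?_, h.1⟩
  have h2 := h.2 0
  rwa [centreE_one, sub_zero] at h2

/-- Points of `P₁` are nonzero vectors. [folklore] -/
theorem ι_ne_zero (q : P1) : ι q ≠ 0 := by
  intro h
  have h1 := (rho_le_norm_and_norm_le_one q).1
  rw [h, norm_zero] at h1
  exact absurd h1 (not_le.2 rho_pos)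

/-- `0 < ‖q‖` on `P₁`. [folklore] -/
theorem norm_ι_pos (q : P1) : 0 < ‖ι q‖ :=
  norm_pos_iff.2 (ι_ne_zero q)

/-- **The interior of `P₁` is the open annulus `ρ < ‖q‖ < 1`.** [folklore] -/
theorem mem_interior_iff_norm (q : P1) :
    q ∈ (𝓡∂ 2).interior P1 ↔ holeRadius 1 < ‖ι q‖ ∧ ‖ι q‖ < 1 := by
  rw [SmoothPlanarPage.mem_interior_iff]
  change ‖ι q‖ < 1 ∧ (∀ j, holeRadius 1 < ‖ι q - centreE 1 j‖) ↔ _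
  constructor
  · rintro ⟨h1, h2⟩
    have h3 := h2 0
    rw [centreE_one, sub_zero] at h3
    exact ⟨h3, h1⟩
  · rintro ⟨h1, h2⟩
    refine ⟨h2, fun j => ?_⟩
    rwa [centreE_one, sub_zero]

/-- In terms of `t = ‖q‖²`: interior points have `ρ² < t < 1`. [folklore] -/
theorem sq_mem_Ioo_of_mem_interior {q : P1} (hq : q ∈ (𝓡∂ 2).interior P1) :
    holeRadius 1 ^ 2 < ‖ι q‖ ^ 2 ∧ ‖ι q‖ ^ 2 < 1 := by
  obtain ⟨h1, h2⟩ := (mem_interior_iff_norm q).1 hq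
  exact ⟨by nlinarith [rho_pos], by nlinarith [norm_nonneg (ι q)]⟩

/-- All points have `ρ² ≤ t ≤ 1`. [folklore] -/
theorem sq_mem_Icc (q : P1) : holeRadius 1 ^ 2 ≤ ‖ι q‖ ^ 2 ∧ ‖ι q‖ ^ 2 ≤ 1 := by
  obtain ⟨h1, h2⟩ := rho_le_norm_and_norm_le_one q
  exact ⟨by nlinarith [rho_pos], by nlinarith [norm_nonneg (ι q)]⟩

/-! ### The radial angle profile `φ(t) = (π/2)(t - ρ²)/(1 - ρ²)` and its inverse -/

/-- **The angle profile** `φ(t) = (π/2) · (t - ρ²)/(1 - ρ²)`: affine, increasing, `φ(ρ²) = 0`,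
`φ(1) = π/2`.  The page system puts the circle `‖q‖² = t` of the annulus at `|z₁| = sin φ(t)`,
`|z₂| = cos φ(t)`. [folklore] -/
def radAngle (t : ℝ) : ℝ :=
  π / 2 * ((t - holeRadius 1 ^ 2) / (1 - holeRadius 1 ^ 2))

/-- The inverse profile `t(a) = ρ² + (1 - ρ²) · a/(π/2)`. [folklore] -/
def tOf (a : ℝ) : ℝ :=
  holeRadius 1 ^ 2 + (1 - holeRadius 1 ^ 2) * (a / (π / 2))

/-- `φ (t(a)) = a`. [folklore] -/
@[simp] theorem radAngle_tOf (a : ℝ) : radAngle (tOf a) = a := by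
  have h := one_sub_rho_sq_pos
  rw [radAngle, tOf]
  field_simp
  ring

/-- `t (φ(t)) = t`. [folklore] -/
@[simp] theorem tOf_radAngle (t : ℝ) : tOf (radAngle t) = t := by
  have h := one_sub_rho_sq_pos
  have hπ : (π : ℝ) ≠ 0 := Real.pi_ne_zero
  rw [radAngle, tOf]
  field_simp
  ring

/-- `φ` is injective. [folklore] -/
theorem radAngle_injective : Function.Injective radAngle :=
  HasLeftInverse.injective ⟨tOf, tOf_radAngle⟩

/-- `φ` as an affine function: `φ t = c (t - ρ²)` with `c = (π/2)/(1 - ρ²) > 0`. [folklore] -/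
theorem radAngle_eq (t : ℝ) : radAngle t = π / 2 / (1 - holeRadius 1 ^ 2) * (t - holeRadius 1 ^ 2) := by
  rw [radAngle]; ring

/-- `φ` is strictly increasing. [folklore] -/
theorem radAngle_strictMono : StrictMono radAngle := by
  intro a b hab
  rw [radAngle_eq, radAngle_eq]
  have hc : 0 < π / 2 / (1 - holeRadius 1 ^ 2) := div_pos (by positivity) one_sub_rho_sq_pos
  exact mul_lt_mul_of_pos_left (by linarith) hc

/-- `φ(ρ²) = 0`. [folklore] -/
theorem radAngle_rho_sq : radAngle (holeRadius 1 ^ 2) = 0 := by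
  rw [radAngle, sub_self, zero_div, mul_zero]

/-- `φ(1) = π/2`. [folklore] -/
theorem radAngle_one : radAngle 1 = π / 2 := by
  rw [radAngle, div_self one_sub_rho_sq_pos.ne', mul_one]

/-- On the open annulus `φ ∈ (0, π/2)`. [folklore] -/
theorem radAngle_mem_Ioo {t : ℝ} (h1 : holeRadius 1 ^ 2 < t) (h2 : t < 1) : radAngle t ∈ Ioo 0 (π / 2) := by
  constructor
  · rw [← radAngle_rho_sq]; exact radAngle_strictMono h1
  · rw [← radAngle_one]; exact radAngle_strictMono h2

/-- On the closed annulus `φ ∈ [0, π/2]`. [folklore] -/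
theorem radAngle_mem_Icc {t : ℝ} (h1 : holeRadius 1 ^ 2 ≤ t) (h2 : t ≤ 1) : radAngle t ∈ Icc 0 (π / 2) := by
  constructor
  · rw [← radAngle_rho_sq]; exact radAngle_strictMono.monotone h1
  · rw [← radAngle_one]; exact radAngle_strictMono.monotone h2

/-- On the open annulus `sin φ > 0`. [folklore] -/
theorem sin_radAngle_pos {t : ℝ} (h1 : holeRadius 1 ^ 2 < t) (h2 : t < 1) : 0 < Real.sin (radAngle t) := by
  obtain ⟨ha, hb⟩ := radAngle_mem_Ioo h1 h2
  exact Real.sin_pos_of_pos_of_lt_pi ha (by linarith [Real.pi_pos])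

/-- On the open annulus `cos φ > 0`. [folklore] -/
theorem cos_radAngle_pos {t : ℝ} (h1 : holeRadius 1 ^ 2 < t) (h2 : t < 1) : 0 < Real.cos (radAngle t) := by
  obtain ⟨ha, hb⟩ := radAngle_mem_Ioo h1 h2
  exact Real.cos_pos_of_mem_Ioo ⟨by linarith [Real.pi_pos], hb⟩

/-- `φ` is `C^∞`. [folklore] -/
theorem contDiff_radAngle : ContDiff ℝ ∞ radAngle := by
  have h : radAngle = fun t => π / 2 / (1 - holeRadius 1 ^ 2) * (t - holeRadius 1 ^ 2) := funext radAngle_eq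
  rw [h]
  exact contDiff_const.mul (contDiff_id.sub contDiff_const)

/-- `tOf` is `C^∞`. [folklore] -/
theorem contDiff_tOf : ContDiff ℝ ∞ tOf :=
  contDiff_const.add (contDiff_const.mul (contDiff_id.div_const _))

/-! ### The page angle `e(θ) = e^{2πiθ}` -/

/-- `e(θ) = exp(2πiθ)`. [folklore] -/
def expTurn (θ : ℝ) : ℂ :=
  Complex.exp (((2 * π * θ : ℝ) : ℂ) * Complex.I)

/-- `|e(θ)| = 1`. [folklore] -/
@[simp] theorem norm_expTurn (θ : ℝ) : ‖expTurn θ‖ = 1 :=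
  Complex.norm_exp_ofReal_mul_I _

/-- `e(θ) ≠ 0`. [folklore] -/
theorem expTurn_ne_zero (θ : ℝ) : expTurn θ ≠ 0 :=
  Complex.exp_ne_zero _

/-- `e` is `1`-periodic. [folklore] -/
theorem expTurn_add_one (θ : ℝ) : expTurn (θ + 1) = expTurn θ := by
  rw [expTurn, expTurn]
  have h : (((2 * π * (θ + 1) : ℝ) : ℂ) * Complex.I) =
      ((2 * π * θ : ℝ) : ℂ) * Complex.I + 2 * π * Complex.I := by
    push_cast; ring
  rw [h, Complex.exp_add, Complex.exp_two_pi_mul_I, mul_one]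

/-- `e(a + b) = e(a) e(b)`. [folklore] -/
theorem expTurn_add (a b : ℝ) : expTurn (a + b) = expTurn a * expTurn b := by
  rw [expTurn, expTurn, expTurn, ← Complex.exp_add]
  congr 1
  push_cast; ring

/-- `e(0) = 1`. [folklore] -/
@[simp] theorem expTurn_zero : expTurn 0 = 1 := by
  simp [expTurn]

/-- `e(-a) e(a) = 1`. [folklore] -/
theorem expTurn_neg_mul (a : ℝ) : expTurn (-a) * expTurn a = 1 := by
  rw [← expTurn_add, neg_add_cancel, expTurn_zero]

/-- **`e(θ)` read in `ℝ²` is the tree's `circlePt θ = (cos 2πθ, sin 2πθ)`.** [folklore] -/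
theorem cIso_symm_expTurn (θ : ℝ) : cIso.symm (expTurn θ) = (circlePt θ : E2) := by
  ext i
  fin_cases i
  · change cIso.symm (expTurn θ) 0 = (circlePt θ : E2) 0
    rw [cIso_symm_apply_zero, circlePt_apply_zero, expTurn, Complex.exp_ofReal_mul_I_re]
  · change cIso.symm (expTurn θ) 1 = (circlePt θ : E2) 1
    rw [cIso_symm_apply_one, circlePt_apply_one, expTurn, Complex.exp_ofReal_mul_I_im]

/-- `e` is `C^∞`. [folklore] -/
theorem contDiff_expTurn : ContDiff ℝ ∞ expTurn := by
  have h1 : ContDiff ℝ ∞ fun θ : ℝ => ((2 * π * θ : ℝ) : ℂ) :=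
    Complex.ofRealCLM.contDiff.comp (contDiff_const.mul contDiff_id)
  exact (h1.mul contDiff_const).cexp

/-- For `|s| < π`, `arg (e(s/2π)) = s`: the argument of `e^{is}`. [folklore] -/
theorem arg_expTurn {a : ℝ} (ha : |a| < 1 / 2) : Complex.arg (expTurn a) = 2 * π * a := by
  rw [expTurn, Complex.arg_exp_mul_I, toIocMod_eq_self]
  rw [abs_lt] at ha
  constructor <;> nlinarith [Real.pi_pos]

/-! ### The ambient page map `Jamb (q, θ) = (sin φ · q/‖q‖, cos φ · e(θ) q̄/‖q‖)` -/

/-- The first complex coordinate `z₁ = (sin φ(‖q‖²)/‖q‖) q`. [folklore] -/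
def z₁amb (q : E2) : E2 :=
  (Real.sin (radAngle (‖q‖ ^ 2)) / ‖q‖) • q

/-- The second complex coordinate `z₂ = (cos φ(‖q‖²)/‖q‖) · e(θ) q̄`. [folklore] -/
def z₂amb (q : E2) (θ : ℝ) : E2 :=
  (Real.cos (radAngle (‖q‖ ^ 2)) / ‖q‖) • cIso.symm (expTurn θ * conj (cIso q))

/-- **The ambient page map** `(q, θ) ↦ (z₁, z₂) ∈ ℝ⁴`. [folklore] -/
def Jamb (x : E2 × ℝ) : E4 :=
  join (z₁amb x.1, z₂amb x.1 x.2)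

/-- `z₁` of the page map. [folklore] -/
@[simp] theorem pr₁_Jamb (x : E2 × ℝ) : pr₁ (Jamb x) = z₁amb x.1 := by
  rw [Jamb, pr₁_join]

/-- `z₂` of the page map. [folklore] -/
@[simp] theorem pr₂_Jamb (x : E2 × ℝ) : pr₂ (Jamb x) = z₂amb x.1 x.2 := by
  rw [Jamb, pr₂_join]

/-- `‖z₁‖ = |sin φ|` for `q ≠ 0`. [folklore] -/
theorem norm_z₁amb {q : E2} (hq : q ≠ 0) : ‖z₁amb q‖ = |Real.sin (radAngle (‖q‖ ^ 2))| := by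
  have hn : ‖q‖ ≠ 0 := norm_ne_zero_iff.2 hq
  rw [z₁amb, norm_smul, Real.norm_eq_abs, abs_div, abs_norm, div_mul_cancel₀ _ hn]

/-- `‖e(θ) q̄‖ = ‖q‖` (in `ℝ²`). [folklore] -/
theorem norm_cIso_symm_expTurn_mul_conj (q : E2) (θ : ℝ) : ‖cIso.symm (expTurn θ * conj (cIso q))‖ = ‖q‖ := by
  rw [norm_cIso_symm, norm_mul, norm_expTurn, one_mul, Complex.norm_conj, norm_cIso]

/-- `‖z₂‖ = |cos φ|` for `q ≠ 0`. [folklore] -/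
theorem norm_z₂amb {q : E2} (hq : q ≠ 0) (θ : ℝ) : ‖z₂amb q θ‖ = |Real.cos (radAngle (‖q‖ ^ 2))| := by
  have hn : ‖q‖ ≠ 0 := norm_ne_zero_iff.2 hq
  rw [z₂amb, norm_smul, Real.norm_eq_abs, abs_div, abs_norm, norm_cIso_symm_expTurn_mul_conj,
    div_mul_cancel₀ _ hn]

/-- **The page map lands in `S³`** for `q ≠ 0`: `‖z₁‖² + ‖z₂‖² = sin² φ + cos² φ = 1`. [folklore] -/
theorem norm_Jamb {x : E2 × ℝ} (hx : x.1 ≠ 0) : ‖Jamb x‖ = 1 := by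
  have h : ‖Jamb x‖ ^ 2 = 1 := by
    rw [Jamb, norm_sq_join]
    change ‖z₁amb x.1‖ ^ 2 + ‖z₂amb x.1 x.2‖ ^ 2 = 1
    rw [norm_z₁amb hx, norm_z₂amb hx, sq_abs, sq_abs, Real.sin_sq_add_cos_sq]
  exact (pow_eq_one_iff_of_nonneg (norm_nonneg _) two_ne_zero).1 h

/-- `cIso q · conj (cIso q) = ‖q‖²`. [folklore] -/
theorem cIso_mul_conj (q : E2) : cIso q * conj (cIso q) = ((‖q‖ ^ 2 : ℝ) : ℂ) := by
  rw [Complex.mul_conj, Complex.normSq_eq_norm_sq, norm_cIso]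

/-- **`z₁ z₂` of the page map**: `hmul (Jamb (q, θ)) = sin φ cos φ · e(θ)` for `q ≠ 0`. [folklore] -/
theorem hmul_Jamb {q : E2} (hq : q ≠ 0) (θ : ℝ) :
    hmul (Jamb (q, θ)) = ((Real.sin (radAngle (‖q‖ ^ 2)) * Real.cos (radAngle (‖q‖ ^ 2)) : ℝ) : ℂ) * expTurn θ := by
  have hn : (‖q‖ : ℂ) ≠ 0 := by exact_mod_cast norm_ne_zero_iff.2 hq
  rw [hmul, pr₁_Jamb, pr₂_Jamb, z₁amb, z₂amb, cIso_smul, cIso_smul, cIso.apply_symm_apply]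
  have key : cIso q * (expTurn θ * conj (cIso q)) = ((‖q‖ ^ 2 : ℝ) : ℂ) * expTurn θ := by
    rw [show cIso q * (expTurn θ * conj (cIso q)) = expTurn θ * (cIso q * conj (cIso q)) by ring, cIso_mul_conj,
      mul_comm]
  calc ((Real.sin (radAngle (‖q‖ ^ 2)) / ‖q‖ : ℝ) : ℂ) * cIso q *
        (((Real.cos (radAngle (‖q‖ ^ 2)) / ‖q‖ : ℝ) : ℂ) * (expTurn θ * conj (cIso q)))
      = ((Real.sin (radAngle (‖q‖ ^ 2)) / ‖q‖ : ℝ) : ℂ) * ((Real.cos (radAngle (‖q‖ ^ 2)) / ‖q‖ : ℝ) : ℂ) *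
          (cIso q * (expTurn θ * conj (cIso q))) := by ring
    _ = ((Real.sin (radAngle (‖q‖ ^ 2)) / ‖q‖ : ℝ) : ℂ) * ((Real.cos (radAngle (‖q‖ ^ 2)) / ‖q‖ : ℝ) : ℂ) *
          (((‖q‖ ^ 2 : ℝ) : ℂ) * expTurn θ) := by rw [key]
    _ = ((Real.sin (radAngle (‖q‖ ^ 2)) * Real.cos (radAngle (‖q‖ ^ 2)) : ℝ) : ℂ) * expTurn θ := by
          push_cast
          field_simp

/-- **`z₁ z₂` of the page map read in `ℝ²`**: `mvec (Jamb (q, θ)) = (sin φ cos φ) • circlePt θ`.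
[folklore] -/
theorem mvec_Jamb {q : E2} (hq : q ≠ 0) (θ : ℝ) :
    mvec (Jamb (q, θ)) = (Real.sin (radAngle (‖q‖ ^ 2)) * Real.cos (radAngle (‖q‖ ^ 2))) • (circlePt θ : E2) := by
  rw [mvec, hmul_Jamb hq, ← Complex.real_smul, LinearIsometryEquiv.map_smul, cIso_symm_expTurn]

/-! ### Smoothness of the ambient page map off `q = 0` -/

/-- The page map is `C^∞` on `{q ≠ 0} × ℝ`. [folklore] -/
theorem contDiffOn_Jamb : ContDiffOn ℝ ∞ Jamb {x : E2 × ℝ | x.1 ≠ 0} := by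
  have hn : ContDiffOn ℝ ∞ (fun x : E2 × ℝ => ‖x.1‖) {x : E2 × ℝ | x.1 ≠ 0} := fun x hx =>
    (contDiffAt_fst.norm ℝ hx).contDiffWithinAt
  have hn0 : ∀ x ∈ {x : E2 × ℝ | x.1 ≠ 0}, ‖x.1‖ ≠ 0 := fun x hx => norm_ne_zero_iff.2 hx
  have hphi : ContDiff ℝ ∞ fun x : E2 × ℝ => radAngle (‖x.1‖ ^ 2) :=
    contDiff_radAngle.comp ((contDiff_norm_sq ℝ).comp contDiff_fst)
  have hsin : ContDiff ℝ ∞ fun x : E2 × ℝ => Real.sin (radAngle (‖x.1‖ ^ 2)) := Real.contDiff_sin.comp hphi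
  have hcos : ContDiff ℝ ∞ fun x : E2 × ℝ => Real.cos (radAngle (‖x.1‖ ^ 2)) := Real.contDiff_cos.comp hphi
  have hz₁ : ContDiffOn ℝ ∞ (fun x : E2 × ℝ => z₁amb x.1) {x : E2 × ℝ | x.1 ≠ 0} :=
    (hsin.contDiffOn.div hn hn0).smul contDiffOn_fst
  have hrot : ContDiff ℝ ∞ fun x : E2 × ℝ => cIso.symm (expTurn x.2 * conj (cIso x.1)) :=
    contDiff_cIso_symm.comp ((contDiff_expTurn.comp contDiff_snd).mul
      (Complex.conjCLE.contDiff.comp (contDiff_cIso.comp contDiff_fst)))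
  have hz₂ : ContDiffOn ℝ ∞ (fun x : E2 × ℝ => z₂amb x.1 x.2) {x : E2 × ℝ | x.1 ≠ 0} :=
    (hcos.contDiffOn.div hn hn0).smul hrot.contDiffOn
  exact join.contDiff.comp_contDiffOn (hz₁.prodMk hz₂)

/-! ### The page system `J : P₁ × ℝ → S³` -/

/-- The page map of a point of `P₁ × ℝ` lies on `S³`. [folklore] -/
theorem Jamb_mem (x : P1 × ℝ) : Jamb (ι x.1, x.2) ∈ S3 :=
  mem_sphere_zero_iff_norm.2 (norm_Jamb (x := (ι x.1, x.2)) (ι_ne_zero x.1))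

/-- **THE PAGE SYSTEM OF THE HOPF OPEN BOOK BY THE ANNULUS `P₁`**:
`J (q, θ) = (sin φ(‖q‖²) · q/‖q‖, cos φ(‖q‖²) · e^{2πiθ} q̄/‖q‖) ∈ S³`.  Page by page it carries
the open annulus `{ρ < ‖q‖ < 1}` onto the page `{z₁z₂ ∈ ℝ₊ e^{2πiθ}}` of the Hopf open book; it is
a fibrewise trivialisation `int P₁ × S¹ ≅ S³ ∖ (Hopf link)` of the page bundle — possible because
the monodromy, a Dehn twist about the core, is isotopic to the identity through diffeomorphisms of
the OPEN annulus (the twist is undone by rotating the ends; here the `θ`-dependence `e^{2πiθ} q̄`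
rotates the inner and outer ends against each other once per turn). [folklore] -/
def hopfPages : P1 × ℝ → S3 :=
  Set.codRestrict (fun x : P1 × ℝ => Jamb (ι x.1, x.2)) _ Jamb_mem

/-- The page system read in `ℝ⁴`. [folklore] -/
@[simp] theorem coe_hopfPages (x : P1 × ℝ) : (hopfPages x : E4) = Jamb (ι x.1, x.2) := rfl

/-- `(q, θ) ↦ (q, θ) ∈ ℝ² × ℝ` is `C^∞` on `P₁ × ℝ` (the inclusion of the regular sublevel set is
`C^∞`, `RegularSublevel.contMDiff_incl`). [folklore] -/
theorem contMDiff_ιProd :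
    ContMDiff ((𝓡∂ 2).prod 𝓘(ℝ, ℝ)) 𝓘(ℝ, E2 × ℝ) ∞ fun x : P1 × ℝ => (ι x.1, x.2) :=
  ((RegularSublevel.contMDiff_incl _).comp contMDiff_fst).prodMk_space contMDiff_snd

/-- **The page system is `C^∞` on all of `P₁ × ℝ`** (hence on `int P₁ × ℝ`). [folklore] -/
theorem contMDiff_hopfPages : ContMDiff ((𝓡∂ 2).prod 𝓘(ℝ, ℝ)) (𝓡 3) ∞ hopfPages := by
  have h1 := contMDiff_ιProd
  have h2 := ContMDiffOn.comp_contMDiff contDiffOn_Jamb.contMDiffOn h1 fun x => ι_ne_zero x.1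
  exact h2.codRestrict_sphere _

/-- The page system is `1`-periodic in the angle. [folklore] -/
theorem hopfPages_add_one (q : P1) (θ : ℝ) : hopfPages (q, θ + 1) = hopfPages (q, θ) := by
  apply Subtype.ext
  simp only [coe_hopfPages, Jamb, z₂amb, expTurn_add_one]

/-- **`z₁z₂` along the page system**: `mvec (J (q, θ)) = (sin φ cos φ) • circlePt θ`. [folklore] -/
theorem mvec_hopfPages (q : P1) (θ : ℝ) :
    mvec (hopfPages (q, θ) : E4) =
      (Real.sin (radAngle (‖ι q‖ ^ 2)) * Real.cos (radAngle (‖ι q‖ ^ 2))) • (circlePt θ : E2) := by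
  rw [coe_hopfPages]
  exact mvec_Jamb (ι_ne_zero q) θ

/-- On the open annulus `sin φ cos φ > 0`. [folklore] -/
theorem sin_mul_cos_pos {q : P1} (hq : q ∈ (𝓡∂ 2).interior P1) :
    0 < Real.sin (radAngle (‖ι q‖ ^ 2)) * Real.cos (radAngle (‖ι q‖ ^ 2)) := by
  obtain ⟨h1, h2⟩ := sq_mem_Ioo_of_mem_interior hq
  exact mul_pos (sin_radAngle_pos h1 h2) (cos_radAngle_pos h1 h2)

/-- Interior points go off the Hopf link. [folklore] -/
theorem hmul_hopfPages_ne_zero {q : P1} (hq : q ∈ (𝓡∂ 2).interior P1) (θ : ℝ) :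
    hmul (hopfPages (q, θ) : E4) ≠ 0 := by
  rw [Ne, ← mvec_eq_zero_iff, mvec_hopfPages]
  exact smul_ne_zero (sin_mul_cos_pos hq).ne' (ne_zero_of_mem_unit_sphere (circlePt θ))

/-- **The page system reads the angle**: `π (J (q, θ)) = circlePt θ` on the open annulus. [folklore] -/
theorem proj_hopfPages {q : P1} (hq : q ∈ (𝓡∂ 2).interior P1) (θ : ℝ) :
    proj (hopfPages (q, θ)) = circlePt θ := by
  rw [proj, mvec_hopfPages, RotationBody.sphN_smul (sin_mul_cos_pos hq)
    (ne_zero_of_mem_unit_sphere (circlePt θ)), RotationBody.sphN_coe]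

/-- **Interior points land on the page of the prescribed angle.** [folklore] -/
theorem hopfPages_mem_page {q : P1} (hq : q ∈ (𝓡∂ 2).interior P1) (θ : ℝ) :
    hopfPages (q, θ) ∈ hopfOpenBook.page (circlePt θ) := by
  rw [OpenBook.mem_page_iff, not_mem_binding_iff]
  exact ⟨hmul_hopfPages_ne_zero hq θ, proj_hopfPages hq θ⟩

/-! ### Injectivity on each page -/

/-- `‖z₁ (J (q, θ))‖ = sin φ(‖q‖²)`. [folklore] -/
theorem norm_pr₁_hopfPages (q : P1) (θ : ℝ) :
    ‖pr₁ (hopfPages (q, θ) : E4)‖ = Real.sin (radAngle (‖ι q‖ ^ 2)) := by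
  rw [coe_hopfPages, pr₁_Jamb, norm_z₁amb (ι_ne_zero q), abs_of_nonneg]
  obtain ⟨h1, h2⟩ := sq_mem_Icc q
  obtain ⟨ha, hb⟩ := radAngle_mem_Icc h1 h2
  exact Real.sin_nonneg_of_nonneg_of_le_pi ha (by linarith [Real.pi_pos])

/-- **The page system is injective on each page** (indeed on all of `P₁` for fixed `θ`): `z₁`
determines `sin φ(‖q‖²)`, hence `‖q‖`, hence `q`. [folklore] -/
theorem injective_hopfPages_left (θ : ℝ) : Injective fun q : P1 => hopfPages (q, θ) := by
  intro q q' h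
  change hopfPages (q, θ) = hopfPages (q', θ) at h
  have h1 : pr₁ (hopfPages (q, θ) : E4) = pr₁ (hopfPages (q', θ) : E4) := by rw [h]
  have hs : Real.sin (radAngle (‖ι q‖ ^ 2)) = Real.sin (radAngle (‖ι q'‖ ^ 2)) := by
    rw [← norm_pr₁_hopfPages q θ, ← norm_pr₁_hopfPages q' θ, h1]
  have hφ : radAngle (‖ι q‖ ^ 2) = radAngle (‖ι q'‖ ^ 2) := by
    obtain ⟨a1, a2⟩ := sq_mem_Icc q
    obtain ⟨b1, b2⟩ := sq_mem_Icc q'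
    obtain ⟨ha, hb⟩ := radAngle_mem_Icc a1 a2
    obtain ⟨ha', hb'⟩ := radAngle_mem_Icc b1 b2
    exact Real.injOn_sin ⟨by linarith [Real.pi_pos], hb⟩ ⟨by linarith [Real.pi_pos], hb'⟩ hs
  have ht : ‖ι q‖ ^ 2 = ‖ι q'‖ ^ 2 := radAngle_injective hφ
  have hn : ‖ι q‖ = ‖ι q'‖ := by
    nlinarith [norm_nonneg (ι q), norm_nonneg (ι q'), sq_nonneg (‖ι q‖ - ‖ι q'‖),
      sq_nonneg (‖ι q‖ + ‖ι q'‖)]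
  rw [coe_hopfPages, coe_hopfPages, pr₁_Jamb, pr₁_Jamb, z₁amb, z₁amb] at h1
  change (Real.sin (radAngle (‖ι q‖ ^ 2)) / ‖ι q‖) • ι q = (Real.sin (radAngle (‖ι q'‖ ^ 2)) / ‖ι q'‖) • ι q' at h1
  rw [hn] at h1
  by_cases hc : Real.sin (radAngle (‖ι q'‖ ^ 2)) / ‖ι q'‖ = 0
  · -- then `sin φ = 0`, i.e. both points lie on the inner circle `‖q‖ = ρ`; but then `z₂`… we
    -- argue directly: `sin φ = 0` with `φ ∈ [0, π/2]` forces `φ = 0`, `‖q‖ = ρ`; injectivity of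
    -- the remaining datum `q ↦ e(θ) q̄` does the rest.
    have h2 : pr₂ (hopfPages (q, θ) : E4) = pr₂ (hopfPages (q', θ) : E4) := by rw [h]
    rw [coe_hopfPages, coe_hopfPages, pr₂_Jamb, pr₂_Jamb, z₂amb, z₂amb, hn] at h2
    have hsin0 : Real.sin (radAngle (‖ι q'‖ ^ 2)) = 0 := by
      rcases div_eq_zero_iff.1 hc with h0 | h0
      · exact h0
      · exact absurd h0 (norm_ι_pos q').ne'
    have hcos : Real.cos (radAngle (‖ι q'‖ ^ 2)) ≠ 0 := by
      intro h0
      have := Real.sin_sq_add_cos_sq (radAngle (‖ι q'‖ ^ 2))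
      rw [hsin0, h0] at this
      norm_num at this
    have hc' : Real.cos (radAngle (‖ι q'‖ ^ 2)) / ‖ι q'‖ ≠ 0 := div_ne_zero hcos (norm_ι_pos q').ne'
    have h3 := smul_right_injective E2 hc' h2
    have h4 : expTurn θ * conj (cIso (ι q)) = expTurn θ * conj (cIso (ι q')) := cIso.symm.injective h3
    have h5 : conj (cIso (ι q)) = conj (cIso (ι q')) := mul_left_cancel₀ (expTurn_ne_zero θ) h4
    have h6 : cIso (ι q) = cIso (ι q') := star_injective h5
    exact RegularSublevel.injective_incl _ (cIso.injective h6)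
  · exact RegularSublevel.injective_incl _ (smul_right_injective E2 hc h1)

/-- The page system is injective on the open annulus, page by page (the clause of `IsPageSystem`).
[folklore] -/
theorem injOn_hopfPages (θ : ℝ) :
    InjOn (fun q : P1 => hopfPages (q, θ)) ((𝓡∂ 2).interior P1) :=
  (injective_hopfPages_left θ).injOn

/-! ### Surjectivity onto the complement of the Hopf link -/

/-- Points with `z₂ ≠ 0` have `‖z₁‖ < 1`. [folklore] -/
theorem norm_pr₁_lt_one {y : S3} (hy : pr₂ (y : E4) ≠ 0) : ‖pr₁ (y : E4)‖ < 1 := by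
  have h := norm_sq_pr_add y
  have h2 : 0 < ‖pr₂ (y : E4)‖ ^ 2 := by positivity
  nlinarith [norm_nonneg (pr₁ (y : E4))]

/-- `‖z₂‖ = √(1 - ‖z₁‖²)` on `S³`. [folklore] -/
theorem norm_pr₂_eq_sqrt (y : S3) : ‖pr₂ (y : E4)‖ = √(1 - ‖pr₁ (y : E4)‖ ^ 2) := by
  have h := norm_sq_pr_add y
  rw [eq_comm, Real.sqrt_eq_iff_mul_self_eq (by nlinarith [h, sq_nonneg ‖pr₂ (y : E4)‖])
    (norm_nonneg _)]
  nlinarith [h]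

/-- **Every point off the Hopf link lies on a parametrised page.**  For `y = (w₁, w₂)` with
`w₁w₂ ≠ 0`: `s = ‖w₁‖ ∈ (0, 1)`, `a = arcsin s`, `t = t(a) ∈ (ρ², 1)`, `q = (√t/s) w₁`
(so `‖q‖² = t`, `z₁ = w₁`), and `θ = arg(u)/2π` for the unit complex number
`u = w₂ s/(‖w₂‖ w̄₁)` (so `z₂ = w₂`). [folklore] -/
theorem exists_hopfPages_eq (y : S3) (hy : y ∉ hopfOpenBook.binding) :
    ∃ q ∈ (𝓡∂ 2).interior P1, ∃ θ : ℝ, hopfPages (q, θ) = y := by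
  rw [not_mem_binding_iff, Ne, hmul_eq_zero_iff, not_or] at hy
  obtain ⟨h1, h2⟩ := hy
  set w₁ : E2 := pr₁ (y : E4) with hw₁
  set w₂ : E2 := pr₂ (y : E4) with hw₂
  set s : ℝ := ‖w₁‖ with hs
  have hs0 : 0 < s := norm_pos_iff.2 h1
  have hs1 : s < 1 := norm_pr₁_lt_one h2
  set a : ℝ := Real.arcsin s with ha
  have ha0 : 0 < a := Real.arcsin_pos.2 hs0
  have ha1 : a < π / 2 := Real.arcsin_lt_pi_div_two.2 hs1
  set t : ℝ := tOf a with ht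
  have hρ := one_sub_rho_sq_pos
  have ht0 : holeRadius 1 ^ 2 < t := by
    rw [ht, tOf]
    have : 0 < (1 - holeRadius 1 ^ 2) * (a / (π / 2)) := mul_pos hρ (div_pos ha0 (by positivity))
    linarith
  have ht1 : t < 1 := by
    rw [ht, tOf]
    have : a / (π / 2) < 1 := (div_lt_one (by positivity)).2 ha1
    nlinarith
  have htpos : 0 < t := lt_trans (pow_pos rho_pos 2) ht0
  have hφt : radAngle t = a := by rw [ht, radAngle_tOf]
  have hsin : Real.sin (radAngle t) = s := by
    rw [hφt, ha, Real.sin_arcsin (by linarith) hs1.le]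
  have hcos : Real.cos (radAngle t) = ‖w₂‖ := by
    rw [hφt, ha, Real.cos_arcsin, hw₂, norm_pr₂_eq_sqrt y]
  -- the point of the annulus
  set qv : E2 := (√t / s) • w₁ with hqv
  have hnqv : ‖qv‖ = √t := by
    rw [hqv, norm_smul, Real.norm_eq_abs, abs_of_pos (div_pos (Real.sqrt_pos.2 htpos) hs0), ← hs,
      div_mul_cancel₀ _ hs0.ne']
  have hnqv2 : ‖qv‖ ^ 2 = t := by rw [hnqv, Real.sq_sqrt htpos.le]
  have hqv_in : qv ∈ pageSetE 1 := by
    refine ⟨?_, fun j => ?_⟩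
    · rw [hnqv]; exact (Real.sqrt_le_sqrt ht1.le).trans_eq Real.sqrt_one
    · rw [centreE_one, sub_zero, hnqv, ← Real.sqrt_sq rho_pos.le]
      exact Real.sqrt_le_sqrt ht0.le
  set q : P1 := RegularSublevel.mk _ qv (levelFun_le_zero_iff.2 hqv_in) with hq
  have hιq : ι q = qv := rfl
  have hq_int : q ∈ (𝓡∂ 2).interior P1 := by
    rw [mem_interior_iff_norm, hιq, hnqv]
    exact ⟨(Real.lt_sqrt rho_pos.le).2 ht0, (Real.sqrt_lt' one_pos).2 (by rw [one_pow]; exact ht1)⟩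
  -- the angle
  have hw₂n : 0 < ‖w₂‖ := norm_pos_iff.2 h2
  set u : ℂ := cIso w₂ * (s : ℂ) / ((‖w₂‖ : ℂ) * conj (cIso w₁)) with hu
  have hcj : conj (cIso w₁) ≠ 0 :=
    (map_ne_zero_iff (starRingEnd ℂ) (RingHom.injective _)).2 ((cIso_eq_zero_iff w₁).not.2 h1)
  have hden : ((‖w₂‖ : ℂ) * conj (cIso w₁)) ≠ 0 := mul_ne_zero (by exact_mod_cast hw₂n.ne') hcj
  have hun : ‖u‖ = 1 := by
    rw [hu, norm_div, norm_mul, norm_mul, Complex.norm_conj, norm_cIso, norm_cIso, Complex.norm_real,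
      Complex.norm_real, Real.norm_eq_abs, Real.norm_eq_abs, abs_of_pos hs0, abs_of_pos hw₂n, ← hs,
      mul_comm, div_self (mul_pos hs0 hw₂n).ne']
  set θ : ℝ := Complex.arg u / (2 * π) with hθ
  have heθ : expTurn θ = u := by
    rw [expTurn, hθ]
    have : ((2 * π * (Complex.arg u / (2 * π)) : ℝ) : ℂ) = (Complex.arg u : ℂ) := by
      congr 1; field_simp
    rw [this]
    have h := Complex.norm_mul_exp_arg_mul_I u
    rwa [hun, Complex.ofReal_one, one_mul] at h
  refine ⟨q, hq_int, θ, ?_⟩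
  -- compare coordinates
  apply Subtype.ext
  rw [coe_hopfPages, ← join_pr (y : E4)]
  change join (z₁amb (ι q), z₂amb (ι q) θ) = join (w₁, w₂)
  congr 1
  apply Prod.ext
  · -- `z₁ = w₁`
    change z₁amb (ι q) = w₁
    rw [z₁amb, hιq, hnqv2, hnqv, hsin, hqv, smul_smul]
    have : s / √t * (√t / s) = 1 := by
      field_simp [hs0.ne', (Real.sqrt_pos.2 htpos).ne']
    rw [this, one_smul]
  · -- `z₂ = w₂`
    change z₂amb (ι q) θ = w₂
    apply cIso.injective
    rw [z₂amb, hιq, hnqv2, hnqv, hcos, cIso_smul, cIso.apply_symm_apply, heθ, hqv,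
      cIso_smul, map_mul, Complex.conj_ofReal, hu]
    have hsC : (s : ℂ) ≠ 0 := by exact_mod_cast hs0.ne'
    have htC : ((√t : ℝ) : ℂ) ≠ 0 := by exact_mod_cast (Real.sqrt_pos.2 htpos).ne'
    have hw₂C : ((‖w₂‖ : ℝ) : ℂ) ≠ 0 := by exact_mod_cast hw₂n.ne'
    push_cast
    field_simp

/-! ### The page system is an immersion on the open annulus: a smooth local left inverse -/

/-- The radial part of the local inverse: `G₁(v) = (√(t(arcsin ‖z₁‖))/‖z₁‖) z₁`. [folklore] -/
def G₁ (v : E4) : E2 :=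
  (√(tOf (Real.arcsin ‖pr₁ v‖)) / ‖pr₁ v‖) • pr₁ v

/-- `G₁ ∘ J = q` on the open annulus. [folklore] -/
theorem G₁_hopfPages {q : P1} (hq : q ∈ (𝓡∂ 2).interior P1) (θ : ℝ) :
    G₁ (hopfPages (q, θ) : E4) = ι q := by
  obtain ⟨h1, h2⟩ := sq_mem_Ioo_of_mem_interior hq
  obtain ⟨ha, hb⟩ := radAngle_mem_Ioo h1 h2
  have hsin : 0 < Real.sin (radAngle (‖ι q‖ ^ 2)) := sin_radAngle_pos h1 h2
  have hnorm := norm_pr₁_hopfPages q θ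
  rw [G₁, hnorm, Real.arcsin_sin (by linarith [Real.pi_pos]) hb.le, tOf_radAngle,
    Real.sqrt_sq (norm_nonneg _), coe_hopfPages, pr₁_Jamb, z₁amb, smul_smul]
  have : ‖ι q‖ / Real.sin (radAngle (‖ι q‖ ^ 2)) * (Real.sin (radAngle (‖ι q‖ ^ 2)) / ‖ι q‖) = 1 := by
    field_simp [hsin.ne', (norm_ι_pos q).ne']
  rw [this, one_smul]

/-- `G₁` is `C^∞` at points with `0 < ‖z₁‖ < 1`. [folklore] -/
theorem contDiffAt_G₁ {v : E4} (h0 : pr₁ v ≠ 0) (h1 : ‖pr₁ v‖ < 1) : ContDiffAt ℝ ∞ G₁ v := by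
  have hn : ContDiffAt ℝ ∞ (fun v : E4 => ‖pr₁ v‖) v := (pr₁.contDiff.contDiffAt).norm ℝ h0
  have hpos : 0 < ‖pr₁ v‖ := norm_pos_iff.2 h0
  have hne : ‖pr₁ v‖ ≠ -1 := ne_of_gt (by linarith [norm_nonneg (pr₁ v)])
  -- bottom-up (`Real.arcsin` is itself a `Function.comp` term, which confuses `ContDiffAt.comp`
  -- when elaborated against a `fun`-statement)
  have harc := (Real.contDiffAt_arcsin (n := ∞) hne h1.ne).comp v hn
  have ht := (contDiff_tOf.contDiffAt (n := ∞)).comp v harc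
  have htpos : 0 < tOf (Real.arcsin ‖pr₁ v‖) := by
    rw [tOf]
    have : 0 ≤ (1 - holeRadius 1 ^ 2) * (Real.arcsin ‖pr₁ v‖ / (π / 2)) :=
      mul_nonneg one_sub_rho_sq_pos.le (div_nonneg (Real.arcsin_nonneg.2 hpos.le) (by positivity))
    have : 0 < holeRadius 1 ^ 2 := pow_pos rho_pos 2
    linarith
  have hsq := ht.sqrt htpos.ne'
  have hfin := (hsq.div hn hpos.ne').smul (pr₁.contDiff.contDiffAt (n := ∞))
  exact hfin

/-- The angular part of the local inverse about the angle `θ₀`: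
`G₂(v) = θ₀ + arg(e(-θ₀) z₁z₂(v))/2π`. [folklore] -/
def G₂ (θ₀ : ℝ) (v : E4) : ℝ :=
  θ₀ + (Complex.log (expTurn (-θ₀) * hmul v)).im / (2 * π)

/-- `G₂ ∘ J = θ` for `|θ - θ₀| < 1/2` on the open annulus. [folklore] -/
theorem G₂_hopfPages {q : P1} (hq : q ∈ (𝓡∂ 2).interior P1) {θ₀ θ : ℝ} (hθ : |θ - θ₀| < 1 / 2) :
    G₂ θ₀ (hopfPages (q, θ) : E4) = θ := by
  have he : expTurn (-θ₀) * expTurn θ = expTurn (θ - θ₀) := by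
    rw [← expTurn_add]; ring_nf
  rw [G₂, coe_hopfPages, hmul_Jamb (ι_ne_zero q), Complex.log_im, mul_left_comm,
    Complex.arg_real_mul _ (sin_mul_cos_pos hq), he, arg_expTurn hθ]
  field_simp
  ring

/-- `G₂` is `C^∞` at `J (q, θ₀)` for `q` in the open annulus (the complex logarithm is smooth on
the slit plane, and `e(-θ₀) z₁z₂ (J (q, θ₀)) = sin φ cos φ > 0`). [folklore] -/
theorem contDiffAt_G₂ {q : P1} (hq : q ∈ (𝓡∂ 2).interior P1) (θ₀ : ℝ) :
    ContDiffAt ℝ ∞ (G₂ θ₀) (hopfPages (q, θ₀) : E4) := by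
  have hval : expTurn (-θ₀) * hmul (hopfPages (q, θ₀) : E4) =
      ((Real.sin (radAngle (‖ι q‖ ^ 2)) * Real.cos (radAngle (‖ι q‖ ^ 2)) : ℝ) : ℂ) := by
    rw [coe_hopfPages, hmul_Jamb (ι_ne_zero q), mul_left_comm, expTurn_neg_mul, mul_one]
  have hslit : expTurn (-θ₀) * hmul (hopfPages (q, θ₀) : E4) ∈ Complex.slitPlane := by
    rw [hval]
    exact Complex.ofReal_mem_slitPlane.2 (sin_mul_cos_pos hq)
  have hf : ContDiffAt ℝ ∞ (fun v : E4 => expTurn (-θ₀) * hmul v) (hopfPages (q, θ₀) : E4) :=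
    contDiffAt_const.mul contDiff_hmul.contDiffAt
  have hlog : ContDiffAt ℝ ∞ (fun v : E4 => Complex.log (expTurn (-θ₀) * hmul v)) (hopfPages (q, θ₀) : E4) :=
    ((Complex.contDiffAt_log hslit).restrict_scalars ℝ).comp (hopfPages (q, θ₀) : E4)
      (f := fun v : E4 => expTurn (-θ₀) * hmul v) hf
  have him : ContDiffAt ℝ ∞ (fun v : E4 => (Complex.log (expTurn (-θ₀) * hmul v)).im)
      (hopfPages (q, θ₀) : E4) :=
    Complex.imCLM.contDiff.contDiffAt.comp _ hlog
  exact contDiffAt_const.add (him.div_const _)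

/-- **The local left inverse** `Ĝ = (G₁, G₂) : S³ → ℝ² × ℝ` about the angle `θ₀`. [folklore] -/
def Ginv (θ₀ : ℝ) (y : S3) : E2 × ℝ :=
  (G₁ (y : E4), G₂ θ₀ (y : E4))

/-- `Ĝ ∘ J = (ι × id)` near any point `(q₀, θ₀)` of `int P₁ × ℝ`. [folklore] -/
theorem Ginv_hopfPages_eventuallyEq {q₀ : P1} (hq₀ : q₀ ∈ (𝓡∂ 2).interior P1) (θ₀ : ℝ) :
    (Ginv θ₀ ∘ hopfPages) =ᶠ[𝓝 (q₀, θ₀)] fun x : P1 × ℝ => (ι x.1, x.2) := by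
  have hopen : IsOpen ((𝓡∂ 2).interior P1) :=
    ModelWithCorners.isOpen_interior (I := 𝓡∂ 2) (M := P1) (n := 1) one_ne_zero
  have hI : IsOpen (Ioo (θ₀ - 1 / 2) (θ₀ + 1 / 2)) := isOpen_Ioo
  have hmem : (q₀, θ₀) ∈ (𝓡∂ 2).interior P1 ×ˢ Ioo (θ₀ - 1 / 2) (θ₀ + 1 / 2) :=
    ⟨hq₀, by constructor <;> linarith⟩
  filter_upwards [(hopen.prod hI).mem_nhds hmem] with x hx
  obtain ⟨hx1, hx2⟩ := hx
  have hθ : |x.2 - θ₀| < 1 / 2 := by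
    rw [abs_lt]; obtain ⟨a, b⟩ := hx2; constructor <;> linarith
  change (G₁ (hopfPages (x.1, x.2) : E4), G₂ θ₀ (hopfPages (x.1, x.2) : E4)) = (ι x.1, x.2)
  rw [G₁_hopfPages hx1, G₂_hopfPages hx1 hθ]

/-- `Ĝ` is `C^∞` at `J (q₀, θ₀)` as a map `S³ → ℝ² × ℝ` (product model). [folklore] -/
theorem contMDiffAt_Ginv {q₀ : P1} (hq₀ : q₀ ∈ (𝓡∂ 2).interior P1) (θ₀ : ℝ) :
    ContMDiffAt (𝓡 3) (𝓘(ℝ, E2).prod 𝓘(ℝ, ℝ)) ∞ (Ginv θ₀) (hopfPages (q₀, θ₀)) := by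
  have h0 : pr₁ (hopfPages (q₀, θ₀) : E4) ≠ 0 := by
    have := hmul_hopfPages_ne_zero hq₀ θ₀
    rw [Ne, hmul_eq_zero_iff, not_or] at this
    exact this.1
  have h1 : ‖pr₁ (hopfPages (q₀, θ₀) : E4)‖ < 1 := by
    have := hmul_hopfPages_ne_zero hq₀ θ₀
    rw [Ne, hmul_eq_zero_iff, not_or] at this
    exact norm_pr₁_lt_one this.2
  have hval : ContMDiffAt (𝓡 3) 𝓘(ℝ, E4) ∞ (Subtype.val : S3 → E4) (hopfPages (q₀, θ₀)) :=
    (contMDiff_coe_sphere (n := 3)).contMDiffAt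
  have hG₁ : ContMDiffAt (𝓡 3) 𝓘(ℝ, E2) ∞ (fun y : S3 => G₁ (y : E4)) (hopfPages (q₀, θ₀)) :=
    (contDiffAt_G₁ h0 h1).contMDiffAt.comp _ hval
  have hG₂ : ContMDiffAt (𝓡 3) 𝓘(ℝ, ℝ) ∞ (fun y : S3 => G₂ θ₀ (y : E4)) (hopfPages (q₀, θ₀)) :=
    (contDiffAt_G₂ hq₀ θ₀).contMDiffAt.comp _ hval
  exact hG₁.prodMk hG₂

/-- **The differential of `(q, θ) ↦ (q, θ)` on `P₁ × ℝ` is injective** (the inclusion of the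
regular sublevel set is an immersion, `RegularSublevel.det_mfderiv_incl_ne_zero`). [folklore] -/
theorem injective_mfderiv_ιProd (x : P1 × ℝ) :
    Injective (mfderiv ((𝓡∂ 2).prod 𝓘(ℝ, ℝ)) (𝓘(ℝ, E2).prod 𝓘(ℝ, ℝ))
      (fun x : P1 × ℝ => (ι x.1, x.2)) x) := by
  set A := mfderiv (𝓡∂ 2) (𝓡 2) (RegularSublevel.incl (PlanarPage.isRegularLevel_levelFun 1)) x.1
    with hA
  have hincl : HasMFDerivAt (𝓡∂ 2) (𝓡 2)
      (RegularSublevel.incl (PlanarPage.isRegularLevel_levelFun 1)) x.1 A :=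
    (((RegularSublevel.contMDiff_incl _) x.1).mdifferentiableAt (by simp)).hasMFDerivAt
  have h1 : HasMFDerivAt ((𝓡∂ 2).prod 𝓘(ℝ, ℝ)) (𝓡 2) (fun x : P1 × ℝ => ι x.1) x
      (A.comp (ContinuousLinearMap.fst ℝ (EuclideanSpace ℝ (Fin 2)) ℝ)) :=
    hincl.comp x (hasMFDerivAt_fst x)
  have h2 : HasMFDerivAt ((𝓡∂ 2).prod 𝓘(ℝ, ℝ)) 𝓘(ℝ, ℝ) (fun x : P1 × ℝ => x.2) x
      (ContinuousLinearMap.snd ℝ (EuclideanSpace ℝ (Fin 2)) ℝ) :=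
    hasMFDerivAt_snd x
  have h := h1.prodMk h2
  rw [h.mfderiv]
  -- `A` is injective: its determinant is nonzero
  have hdet := RegularSublevel.det_mfderiv_incl_ne_zero (PlanarPage.isRegularLevel_levelFun 1) x.1
  set e := LinearMap.equivOfDetNeZero
    (mfderiv (𝓡∂ 2) (𝓡 2) (RegularSublevel.incl (PlanarPage.isRegularLevel_levelFun 1)) x.1).toLinearMap
    hdet with he_def
  have hcoe : e.toLinearMap =
      (mfderiv (𝓡∂ 2) (𝓡 2) (RegularSublevel.incl (PlanarPage.isRegularLevel_levelFun 1)) x.1).toLinearMap :=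
    LinearEquiv.coe_ofIsUnitDet _
  have hAinj : Injective A := by
    rw [hA]
    intro a b h
    have h' : e.toLinearMap a = e.toLinearMap b := by
      rw [hcoe]; exact h
    exact e.injective h'
  intro a b hab
  have hv : A a.1 = A b.1 := by
    have h' := congrArg Prod.fst hab
    exact h'
  have hs : a.2 = b.2 := by
    have h' := congrArg Prod.snd hab
    exact h'
  exact Prod.ext (hAinj hv) hs

/-- **The page system is an immersion on the open annulus**: its differential is injective at
every `(q, θ)` with `q ∈ int P₁` (chain rule through the smooth local left inverse `Ĝ`).
[folklore] -/
theorem injective_mfderiv_hopfPages {q : P1} (hq : q ∈ (𝓡∂ 2).interior P1) (θ : ℝ) :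
    Injective (mfderiv ((𝓡∂ 2).prod 𝓘(ℝ, ℝ)) (𝓡 3) hopfPages (q, θ)) := by
  have hJ : MDifferentiableAt ((𝓡∂ 2).prod 𝓘(ℝ, ℝ)) (𝓡 3) hopfPages (q, θ) :=
    (contMDiff_hopfPages (q, θ)).mdifferentiableAt (by simp)
  have hG : MDifferentiableAt (𝓡 3) (𝓘(ℝ, E2).prod 𝓘(ℝ, ℝ)) (Ginv θ) (hopfPages (q, θ)) :=
    (contMDiffAt_Ginv hq θ).mdifferentiableAt (by simp)
  have hcomp := mfderiv_comp (q, θ) hG hJ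
  have heq := (Ginv_hopfPages_eventuallyEq hq θ).mfderiv_eq
    (I := (𝓡∂ 2).prod 𝓘(ℝ, ℝ)) (I' := 𝓘(ℝ, E2).prod 𝓘(ℝ, ℝ))
  have hinj := injective_mfderiv_ιProd (q, θ)
  rw [← heq, hcomp] at hinj
  refine Function.Injective.of_comp
    (f := ⇑(mfderiv (𝓡 3) (𝓘(ℝ, E2).prod 𝓘(ℝ, ℝ)) (Ginv θ) (hopfPages (q, θ)))) ?_
  exact hinj

/-! ### The page system is a page system -/

/-- **`hopfPages` IS A PAGE SYSTEM of the Hopf open book by the annulus `P₁ = SmoothPlanarPage 1`**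
(`IsPageSystem`, `AchiralLefschetzModel.lean`): smooth, `1`-periodic, page-preserving, injective
and immersive on each open page, and onto the complement of the Hopf link.  So the Hopf open book
of `S³` — whose monodromy is a Dehn twist, NOT the identity rel boundary — is trivialised over the
open annulus exactly as the interface demands of "the open book `(P, id)`": the interface does not
see the boundary behaviour of the trivialisation. [folklore] -/
theorem isPageSystem_hopfPages : IsPageSystem hopfOpenBook hopfPages where
  contMDiffOn := contMDiff_hopfPages.contMDiffOn
  periodic := fun q _ θ => hopfPages_add_one q θ
  mem_page := fun _ hq θ => hopfPages_mem_page hq θ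
  injOn := fun θ => injOn_hopfPages θ
  mfderiv_injective := fun _ hq θ => injective_mfderiv_hopfPages hq θ
  exists_eq := fun y hy => exists_hopfPages_eq y hy

end HopfOpenBook

end Literature.Geometry.Symplectic
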